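import Summits.PneNP.GCT.Max.SF6Arithmetic

/-!
# KYRowMass — row masses of the leading-term count `ltCount` (toolkit for a sharper all-`m` Koszul–Young ceiling, W1′)

The proved all-`m` ceiling `KYCannotSeparatePaddedPerAllM` (threshold `n ≥ 2m+2`) rests on the `p`-free smoothing
`SF6Smoothing.lambda1_le : C(n,k+1)²·C(n²,p) ≤ n²·ltCount n (n²-1-p) k` (Chebyshev twice).  Exact arithmetic (THEORY-2 gen 25,
`calc33-allm`) shows the leading-term method itself certifies every cell from `n = ⌈3m/2⌉` (`5 ≤ m ≤ 24`); the loss sits in the OUTER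
Chebyshev step.  This module isolates the row masses `G(n,c,i) = Σ_{j<n} C(i·n+j, c)` and proves the three exact facts a
`c`-dependent (outer-Chebyshev-free) lower bound needs:

* `rowMass_add_choose`   : `G(n,c,i) + C(i·n, c+1) = C((i+1)·n, c+1)`            (hockey stick on one row);
* `sum_rowMass`          : `Σ_{i<n} G(n,c,i) = C(n², c+1)`;
* `choose_mul_sum_rowMass_le_ltCount` : `C(n,k+1) · Σ_i C(i,k)·G(n,c,i) ≤ n · ltCount n c k`   (inner Chebyshev only);
* `abel_rowMass`         : `Σ_{i≤s} C(i,k+1)·G(n,c,i) + Σ_{i<s} C(i,k)·C((i+1)·n, c+1) = C(s,k+1)·C((s+1)·n, c+1)`  (Abel summation);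
* `mul_choose_le_rowMass`: `n · C(i·n, c) ≤ G(n,c,i)`                                  (monotonicity in the position).

Packaged as the node `KYRowMassIdentities` + `kyRowMassIdentities_holds` (pure arithmetic; no statement about ranks).
HONEST FRAMING: bookkeeping identities about binomial sums only — not a statement about Koszul–Young flattenings, orbit closures,
`per` versus `det`, VP versus VNP or P versus NP; they move no census row. [folklore]
-/

namespace Summit.PneNP.GCT
namespace KYRowMass

open Finset DetKYLeadingTerms SF6Smoothing

/-- Row mass `G(n,c,i) = Σ_{j<n} C(i·n+j, c)`: the hockey-stick weight of row `i` of the `n × n` position grid at target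
exponent `c`. [folklore] -/
def rowMass (n c i : ℕ) : ℕ := ∑ j ∈ range n, (i * n + j).choose c

/-- Hockey stick on one row: `G(n,c,i) + C(i·n, c+1) = C((i+1)·n, c+1)`. [folklore] -/
theorem rowMass_add_choose (n c i : ℕ) :
    rowMass n c i + (i * n).choose (c + 1) = ((i + 1) * n).choose (c + 1) := by
  unfold rowMass
  have h := Finset.sum_range_add (fun t => t.choose c) (i * n) n
  rw [sum_range_choose_eq, sum_range_choose_eq] at h
  rw [show (i + 1) * n = i * n + n by ring, h]
  ring

/-- Partial total mass: `Σ_{i<r} G(n,c,i) = C(r·n, c+1)`. [folklore] -/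
theorem sum_rowMass_eq (n c r : ℕ) : ∑ i ∈ range r, rowMass n c i = (r * n).choose (c + 1) := by
  induction r with
  | zero => simp
  | succ r ih => rw [sum_range_succ, ih, ← rowMass_add_choose n c r]; ring

/-- Total mass: `Σ_{i<n} G(n,c,i) = C(n², c+1)` (`= C(n², p)` at `c = n²-1-p`). [folklore] -/
theorem sum_rowMass (n c : ℕ) : ∑ i ∈ range n, rowMass n c i = (n * n).choose (c + 1) :=
  sum_rowMass_eq n c n

/-- The row mass as a `Fin n`-sum (the shape used inside `ltCount`). [folklore] -/
theorem rowMass_eq_fin_sum (n c i : ℕ) : rowMass n c i = ∑ j : Fin n, (i * n + (j : ℕ)).choose c := by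
  unfold rowMass
  rw [Fin.sum_univ_eq_sum_range (fun j => (i * n + j).choose c) n]

/-- Row-Chebyshev (the inner half of `SF6Smoothing.smoothing`, kept exact in `i`):
`C(n,k+1) · Σ_{i<n} C(i,k)·G(n,c,i) ≤ n · ltCount n c k`. [folklore] -/
theorem choose_mul_sum_rowMass_le_ltCount (n c k : ℕ) :
    n.choose (k + 1) * ∑ i : Fin n, (i : ℕ).choose k * rowMass n c i ≤ n * ltCount n c k := by
  unfold ltCount
  rw [Finset.mul_sum, Finset.mul_sum]
  refine Finset.sum_le_sum fun i _ => ?_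
  have hi := inner_chebyshev n c k i
  rw [rowMass_eq_fin_sum]
  have := Nat.mul_le_mul_left ((i : ℕ).choose k) hi
  calc n.choose (k + 1) * ((i : ℕ).choose k * ∑ j : Fin n, ((i : ℕ) * n + j).choose c)
      = (i : ℕ).choose k * (n.choose (k + 1) * ∑ j : Fin n, ((i : ℕ) * n + j).choose c) := by ring
    _ ≤ (i : ℕ).choose k * (n * ∑ j : Fin n, (j : ℕ).choose k * ((i : ℕ) * n + j).choose c) := this
    _ = n * ∑ j : Fin n, (i : ℕ).choose k * (j : ℕ).choose k * ((i : ℕ) * n + j).choose c := by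
        rw [Finset.mul_sum, Finset.mul_sum, Finset.mul_sum]
        refine Finset.sum_congr rfl fun j _ => ?_
        ring

/-- The same with a `range` sum on the left. [folklore] -/
theorem choose_mul_sum_rowMass_le_ltCount' (n c k : ℕ) :
    n.choose (k + 1) * ∑ i ∈ range n, i.choose k * rowMass n c i ≤ n * ltCount n c k := by
  have h := choose_mul_sum_rowMass_le_ltCount n c k
  rwa [Fin.sum_univ_eq_sum_range (fun i => i.choose k * rowMass n c i) n] at h

/-- Abel summation of the weighted row masses (weights `C(i,k+1)`, `s+1` rows):
`Σ_{i≤s} C(i,k+1)·G(n,c,i) + Σ_{i<s} C(i,k)·C((i+1)·n, c+1) = C(s,k+1)·C((s+1)·n, c+1)`.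
With `s+1 = n` the right-hand side is `C(n-1,k+1)·C(n², c+1)`; the correction sum is what the outer Chebyshev step throws away.
[folklore] -/
theorem abel_rowMass (n c k s : ℕ) :
    ∑ i ∈ range (s + 1), i.choose (k + 1) * rowMass n c i + ∑ i ∈ range s, i.choose k * ((i + 1) * n).choose (c + 1)
      = s.choose (k + 1) * ((s + 1) * n).choose (c + 1) := by
  induction s with
  | zero => simp
  | succ s ih =>
      rw [sum_range_succ (fun i => i.choose (k + 1) * rowMass n c i) (s + 1),
          sum_range_succ (fun i => i.choose k * ((i + 1) * n).choose (c + 1)) s]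
      have hG := rowMass_add_choose n c (s + 1)
      have hP : (s + 1).choose (k + 1) = s.choose k + s.choose (k + 1) := Nat.choose_succ_succ' s k
      -- LHS(s+1) = LHS(s) + C(s+1,k+1)·G_{s+1} + C(s,k)·C((s+1)n, c+1)
      calc ∑ i ∈ range (s + 1), i.choose (k + 1) * rowMass n c i + (s + 1).choose (k + 1) * rowMass n c (s + 1)
            + (∑ i ∈ range s, i.choose k * ((i + 1) * n).choose (c + 1) + s.choose k * ((s + 1) * n).choose (c + 1))
          = (∑ i ∈ range (s + 1), i.choose (k + 1) * rowMass n c i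
              + ∑ i ∈ range s, i.choose k * ((i + 1) * n).choose (c + 1))
            + (s + 1).choose (k + 1) * rowMass n c (s + 1) + s.choose k * ((s + 1) * n).choose (c + 1) := by ring
        _ = s.choose (k + 1) * ((s + 1) * n).choose (c + 1)
            + (s + 1).choose (k + 1) * rowMass n c (s + 1) + s.choose k * ((s + 1) * n).choose (c + 1) := by rw [ih]
        _ = (s + 1).choose (k + 1) * (rowMass n c (s + 1) + ((s + 1) * n).choose (c + 1)) := by
            rw [hP]; ring
        _ = (s + 1).choose (k + 1) * ((s + 1 + 1) * n).choose (c + 1) := by rw [hG]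

/-- The `n`-row instance: `Σ_{i<n} C(i,k+1)·G(n,c,i) + Σ_{i<n-1} C(i,k)·C((i+1)·n, c+1) = C(n-1,k+1)·C(n², c+1)` (`1 ≤ n`).
[folklore] -/
theorem abel_rowMass_sq (n c k : ℕ) (hn : 1 ≤ n) :
    ∑ i ∈ range n, i.choose (k + 1) * rowMass n c i + ∑ i ∈ range (n - 1), i.choose k * ((i + 1) * n).choose (c + 1)
      = (n - 1).choose (k + 1) * (n * n).choose (c + 1) := by
  obtain ⟨s, rfl⟩ : ∃ s, n = s + 1 := ⟨n - 1, by omega⟩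
  simpa using abel_rowMass (s + 1) c k s

/-- Monotonicity in the position: `n · C(i·n, c) ≤ G(n,c,i)` (every entry of row `i` is at least its first). Applied at
`c+1` it bounds the Abel correction: `n · C(i·n, c+1) ≤ G(n,c+1,i)`. [folklore] -/
theorem mul_choose_le_rowMass (n c i : ℕ) : n * (i * n).choose c ≤ rowMass n c i := by
  unfold rowMass
  calc n * (i * n).choose c = ∑ _j ∈ range n, (i * n).choose c := by rw [sum_const, card_range, smul_eq_mul]
    _ ≤ ∑ j ∈ range n, (i * n + j).choose c := sum_le_sum fun j _ => Nat.choose_mono c (Nat.le_add_right _ _)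

/-- Shifted form used with `abel_rowMass`: `n · C((i+1)·n, c+1) ≤ G(n,c+1,i+1)`. [folklore] -/
theorem mul_choose_succ_le_rowMass (n c i : ℕ) : n * ((i + 1) * n).choose (c + 1) ≤ rowMass n (c + 1) (i + 1) :=
  mul_choose_le_rowMass n (c + 1) (i + 1)

/-- Sanity (`n = 3`, `c = 4`, `k = 1`): the row masses are `G = (0, 1+5, 15+35+70) = (0, 6, 120)`, total `126 = C(9,5)`;
row-Chebyshev reads `C(3,2)·(0·0 + 1·6 + 2·120) = 738 ≤ 3·ltCount 3 4 1 = 1083`. -/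
example : rowMass 3 4 0 = 0 ∧ rowMass 3 4 1 = 6 ∧ rowMass 3 4 2 = 120 := by decide
example : (3 : ℕ).choose 2 * (0 * rowMass 3 4 0 + 1 * rowMass 3 4 1 + 2 * rowMass 3 4 2) = 738 ∧ 3 * ltCount 3 4 1 = 1083 := by
  decide

/-- **Node.** The row-mass identities behind a `c`-dependent lower bound for `ltCount` (W1′ toolkit). [folklore] -/
def KYRowMassIdentities : Prop :=
  (∀ n c i : ℕ, rowMass n c i + (i * n).choose (c + 1) = ((i + 1) * n).choose (c + 1)) ∧
  (∀ n c : ℕ, ∑ i ∈ range n, rowMass n c i = (n * n).choose (c + 1)) ∧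
  (∀ n c k : ℕ, n.choose (k + 1) * ∑ i ∈ range n, i.choose k * rowMass n c i ≤ n * ltCount n c k) ∧
  (∀ n c k s : ℕ, ∑ i ∈ range (s + 1), i.choose (k + 1) * rowMass n c i
      + ∑ i ∈ range s, i.choose k * ((i + 1) * n).choose (c + 1) = s.choose (k + 1) * ((s + 1) * n).choose (c + 1)) ∧
  (∀ n c k : ℕ, 1 ≤ n → ∑ i ∈ range n, i.choose (k + 1) * rowMass n c i
      + ∑ i ∈ range (n - 1), i.choose k * ((i + 1) * n).choose (c + 1) = (n - 1).choose (k + 1) * (n * n).choose (c + 1)) ∧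
  (∀ n c i : ℕ, n * (i * n).choose c ≤ rowMass n c i) ∧
  (∀ n c i : ℕ, n * ((i + 1) * n).choose (c + 1) ≤ rowMass n (c + 1) (i + 1))

/-- `KYRowMassIdentities` holds. [folklore] -/
theorem kyRowMassIdentities_holds : KYRowMassIdentities :=
  ⟨rowMass_add_choose, sum_rowMass, choose_mul_sum_rowMass_le_ltCount', abel_rowMass, abel_rowMass_sq,
    mul_choose_le_rowMass, mul_choose_succ_le_rowMass⟩

end KYRowMass
end Summit.PneNP.GCT
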